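import Summits.BirchSwinnertonDyer.BirchSwinnertonDyer.Theorems.EisensteinPrimesAnalyticLambdaCompositeCount
import HarnessLib

/-!
# Route `EisensteinPrimes`, line `mudescent`, cruxes 3/5: the absolute analytic `(μ, λ)`-count from a
# congruence with a FINITE SUM of plane terms, the term of least order unique — the socket of
# THEOREM C / C^mix with ANY number of support primes (helper; THEOREMS ONLY)

Seat `bsd-eis-lam-a` g11 (PROGRAMME PART 1b, ACCEL-LIST (4): ANALYTIC side of
`stub_lambdaCount_offLocus`; items stmt-BirchSwinnertonDyer-19033 / -19035; skeleton owner bsd-eis-ky).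
No definition, no named fact, nothing about any particular curve; closes nothing; moves no label.

WHAT AND WHY (HOME/lam-a-g10/lam-a-MEMO-10.md §3b THEOREM C; HOME/lam-a-g11/lam-a-MEMO-11.md §3b
THEOREM C^mix). On a type-A étale end `E` whose Kummer support `S` is composite, THEOREM A⁺ (MEMO-8)
decomposes the mod-`p` `p`-adic `L`-function (times its raising factor) as a SUM over the planes of a
basis of `V_{p,S}`: `Ḡ_E·P_E = Σ_{q ∈ S} a′_q · Ā_q` in `𝔽_p⟦T⟧`, one term per support prime, each of
known (or bounded) `T`-order — `e_q + (raising)` for an Eisenstein-type `q` (Mazur's prime-level plane,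
THEOREM B′/B″), `e^{ns}_q + (raising)` for a non-split-type `q` (a realising curve, THEOREM C^mix; its
raising of the OTHER planes is by the UNIT `1 + γ_q`). When the least order is attained ONCE, the sum
has exactly that order: `μ(E) = 0` and `λ(E)` is read off. The predecessor file
`EisensteinPrimesAnalyticLambdaCompositeCount` (p577696) proves the TWO-term case; this file proves the
`Finset`-indexed case and the two bookkeeping facts C^mix needs:

* §1 (`Λ`-algebra): `lt_order_map_sum_of_forall_lt` (`a < ord Ā_i` for all `i ∈ t` ⟹
  `a < ord (Σ_{i∈t} A_i)‾`), `hasUnitContent_and_order_map_sum_of_lt` (`i₀ ∈ s`, `ord Ā_{i₀} = a`,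
  `a < ord Ā_i` for `i ≠ i₀` ⟹ `Σ_{i∈s} A_i` has unit content and reduced order `a`),
  `hasUnitContent_and_lam_eq_of_truncCongr_sum` / `…_of_valueCongr_sum` (`G ≡ u·Σ A_i` truncated or by
  values ⟹ `μ(G) = 0 ∧ λ(G) = a`), and `order_map_toZMod_mul_of_isUnit` (a UNIT raising factor — the
  non-split partner's `1 + γ_q`, `isUnit_one_add_frobeniusSeries` — does not change the reduced order).
* §2 (X2 currency, crux 3): `X2.analyticMuLE_zero_and_analyticLambdaEq_of_truncCongr_sum` /
  `…_of_valueCongr_sum`: `X2.AnalyticMuLE W p 0 ∧ X2.AnalyticLambdaEq W p a`.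
* §3 (X1 currency, crux 5 / rows A1–A3): the same two for `X1.MuPart.AnalyticMuLE` /
  `X1.ParitySqueeze.AnalyticLambdaEq`.

HONEST FRAMING. The displayed congruence (`hcong` / `hval`) with its order data is what THEOREM C /
C^mix PROVE ON PAPER (MEMO-10 §3b, MEMO-11 §3b; inputs Mazur 1977 II §16–18 / III §8, Vatsal 2005
Thm 1.1, Ohta 2014 (3.6.2) / Yoo 2023, the realising curves of the census); it is NOT asserted here.
Numerically: THEOREM C 52/52 census cells (kit j292005), ties 44/44 inequality (j292361); THEOREM C^mix's
pre-registered test is kit j295799 (HOME/bsd-eis STATUS, 2026-08-28).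

References: [Mazur1977] III Cor. (8.5); [GreenbergVatsal2000] §1 (9)–(10); [Washington1997] §7.1–7.2;
HOME/lam-a-g10/lam-a-MEMO-10.md §3b; HOME/lam-a-g11/lam-a-MEMO-11.md §3b.
-/

set_option linter.dupNamespace false
set_option autoImplicit false

noncomputable section

open scoped Classical MatrixGroups ModularForm

open PowerSeries CongruenceSubgroup WeierstrassCurve NumberField IsDedekindDomain
  Literature.NumberTheory.EllipticCurves
  Literature.NumberTheory.EllipticCurves.ModularForms
  Literature.NumberTheory.EllipticCurves.Rank1Residual
  Literature.NumberTheory.EllipticCurves.GreenbergVatsal2000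
  Summit.BirchSwinnertonDyer.Rank1Residual
  Summit.BirchSwinnertonDyer.Rank1Residual.X1.MuLambda
  Summit.BirchSwinnertonDyer.Rank1Residual.X11a
  Summit.BirchSwinnertonDyer.Rank1Residual.Iwasawa
  Summit.BirchSwinnertonDyer.Rank1Residual.X2.EulerFactorAlgebra
  Summit.BirchSwinnertonDyer.Rank1Residual.X2.EulerFactorInvariants
  Summit.BirchSwinnertonDyer.Rank1Residual.X2.GreenbergVatsalAnalyticTransferCore
  Summit.BirchSwinnertonDyer.BirchSwinnertonDyer.Theorems
  Summit.BirchSwinnertonDyer.BirchSwinnertonDyer.Theorems.EisensteinPrimesAnalyticLambdaCongruenceTransfer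
  Summit.BirchSwinnertonDyer.BirchSwinnertonDyer.Theorems.EisensteinPrimesAnalyticLambdaValueCongruence
  Summit.BirchSwinnertonDyer.BirchSwinnertonDyer.Theorems.EisensteinPrimesX2AnalyticLambdaResultantCertificate
  Summit.BirchSwinnertonDyer.BirchSwinnertonDyer.Theorems.EisensteinPrimesAnalyticLambdaAbsoluteCount
  Summit.BirchSwinnertonDyer.BirchSwinnertonDyer.Theorems.EisensteinPrimesAnalyticLambdaCompositeCount

namespace Summit.BirchSwinnertonDyer.BirchSwinnertonDyer.Theorems.EisensteinPrimesAnalyticLambdaSumCount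

variable {p : ℕ} [hp : Fact p.Prime]

/-! ## §1. `Λ`-algebra: a finite sum whose least order is attained once -/

section Algebra

variable {ι : Type*}

/-- **A strict lower bound for the order passes to finite sums**: if `a < ord_T Ā_i` for every
`i ∈ t` then `a < ord_T (Σ_{i∈t} A_i)‾` (the empty sum has order `⊤`). [folklore] -/
theorem lt_order_map_sum_of_forall_lt (t : Finset ι) (A : ι → IwasawaAlgebra p) {a : ℕ}
    (h : ∀ i ∈ t, (a : ℕ∞) < (PowerSeries.map (PadicInt.toZMod (p := p)) (A i)).order) :
    (a : ℕ∞) < (PowerSeries.map (PadicInt.toZMod (p := p)) (∑ i ∈ t, A i)).order := by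
  classical
  induction t using Finset.induction_on with
  | empty => simp
  | insert j t hj ih =>
    rw [Finset.sum_insert hj, map_add]
    refine lt_of_lt_of_le ?_ (PowerSeries.min_order_le_order_add _ _)
    exact lt_min (h j (Finset.mem_insert_self j t))
      (ih fun i hi => h i (Finset.mem_insert_of_mem hi))

/-- **Order of a finite sum whose least order is attained once.** If `i₀ ∈ s`, `ord_T Ā_{i₀} = a` and
`a < ord_T Ā_i` for every other `i ∈ s`, then `Σ_{i∈s} A_i` has unit content and reduced order `a` —
the mechanism of THEOREM C / C^mix («the plane of least order wins») for any number of support primes.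
[folklore] -/
theorem hasUnitContent_and_order_map_sum_of_lt (s : Finset ι) (A : ι → IwasawaAlgebra p) {i₀ : ι}
    (hi₀ : i₀ ∈ s) {a : ℕ}
    (ha : (PowerSeries.map (PadicInt.toZMod (p := p)) (A i₀)).order = a)
    (hlt : ∀ i ∈ s, i ≠ i₀ → (a : ℕ∞) < (PowerSeries.map (PadicInt.toZMod (p := p)) (A i)).order) :
    HasUnitContent (∑ i ∈ s, A i) ∧
      (PowerSeries.map (PadicInt.toZMod (p := p)) (∑ i ∈ s, A i)).order = a := by
  classical
  have hB : (a : ℕ∞) < (PowerSeries.map (PadicInt.toZMod (p := p)) (∑ i ∈ s.erase i₀, A i)).order :=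
    lt_order_map_sum_of_forall_lt (s.erase i₀) A fun i hi ↦
      hlt i (Finset.mem_of_mem_erase hi) (Finset.ne_of_mem_erase hi)
  rw [← Finset.add_sum_erase s A hi₀]
  exact EisensteinPrimesAnalyticLambdaCompositeCount.hasUnitContent_and_order_map_add_of_lt ha hB

/-- **Congruence with a finite sum whose least order is attained once ⟹ `μ = 0` and `λ = ` that
order.** If `[T^j]Ḡ = u·[T^j](Σ_{i∈s} A_i)‾` in `𝔽_p` for all `j < K`, `u ≠ 0`, `ord_T Ā_{i₀} = a`
(`i₀ ∈ s`), `a < ord_T Ā_i` for the other `i ∈ s`, and `a < K`, then `G` has unit content and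
`λ(G) = a` — THEOREM C / C^mix with `#S` support primes. [cite: GreenbergVatsal2000, §1 (9)–(10)] [cite: Washington1997, §7.1] -/
theorem hasUnitContent_and_lam_eq_of_truncCongr_sum {G : IwasawaAlgebra p} (s : Finset ι)
    (A : ι → IwasawaAlgebra p) {i₀ : ι} (hi₀ : i₀ ∈ s) {a : ℕ}
    (ha : (PowerSeries.map (PadicInt.toZMod (p := p)) (A i₀)).order = a)
    (hlt : ∀ i ∈ s, i ≠ i₀ → (a : ℕ∞) < (PowerSeries.map (PadicInt.toZMod (p := p)) (A i)).order)
    {u : ZMod p} (hu : u ≠ 0) {K : ℕ}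
    (hcong : ∀ j < K, PowerSeries.coeff j (PowerSeries.map (PadicInt.toZMod (p := p)) G) =
      u * PowerSeries.coeff j (PowerSeries.map (PadicInt.toZMod (p := p)) (∑ i ∈ s, A i)))
    (hK : a < K) : HasUnitContent G ∧ lam G = a := by
  obtain ⟨hS, hord⟩ := hasUnitContent_and_order_map_sum_of_lt s A hi₀ ha hlt
  have hK' : (PowerSeries.map (PadicInt.toZMod (p := p)) (∑ i ∈ s, A i)).order < K := by
    rw [hord]; exact_mod_cast hK
  obtain ⟨hG, h⟩ :=
    EisensteinPrimesAnalyticLambdaCongruenceTransfer.hasUnitContent_and_order_eq_of_truncCongr hu hcong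
      hS hK'
  refine ⟨hG, ?_⟩
  have hl := natCast_lam_eq_order_map_toZMod hG
  rw [h, hord] at hl
  exact_mod_cast hl

/-- **The same fed by VALUES at the `p`-power roots of unity** (`‖(G − C(c)·Σ A_i)(ζ − 1)‖ ≤ 1/p` for
all primitive `p^{m+1}`-th roots `ζ`, `m ≥ n₀`, one unit `c ∈ ℤ_p` — THEOREM A⁺'s output currency).
[cite: Washington1997, §7.1–7.2, Thm. 7.3] -/
theorem hasUnitContent_and_lam_eq_of_valueCongr_sum {G : IwasawaAlgebra p} (s : Finset ι)
    (A : ι → IwasawaAlgebra p) {i₀ : ι} (hi₀ : i₀ ∈ s) {a : ℕ}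
    (ha : (PowerSeries.map (PadicInt.toZMod (p := p)) (A i₀)).order = a)
    (hlt : ∀ i ∈ s, i ≠ i₀ → (a : ℕ∞) < (PowerSeries.map (PadicInt.toZMod (p := p)) (A i)).order)
    {c : ℤ_[p]} (hc : IsUnit c) {n₀ : ℕ}
    (hval : ∀ m : ℕ, n₀ ≤ m → ∀ ζ : ℂ_[p], IsPrimitiveRoot ζ (p ^ (m + 1)) →
      ‖∑' k, ((algebraMap ℚ_[p] ℂ_[p]).comp (algebraMap ℤ_[p] ℚ_[p]))
          (PowerSeries.coeff k (G - PowerSeries.C c * ∑ i ∈ s, A i)) * (ζ - 1) ^ k‖ ≤ (p : ℝ)⁻¹) :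
    HasUnitContent G ∧ lam G = a :=
  hasUnitContent_and_lam_eq_of_truncCongr_sum s A hi₀ ha hlt
    (EisensteinPrimesAnalyticLambdaValueCongruence.toZMod_ne_zero_of_isUnit hc) (K := a + 1)
    (fun j _ ↦ EisensteinPrimesAnalyticLambdaValueCongruence.forall_coeff_toZMod_eq_of_forall_norm_tsum_le
      hval j) (Nat.lt_succ_self _)

/-- **A unit raising factor does not change the reduced order**: `ord_T (A·V)‾ = ord_T Ā` for `V ∈ Λˣ`
— the bookkeeping remark of THEOREM C^mix: a NON-SPLIT support partner `q ≡ −1 (mod p)` raises every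
other plane by the unit `1 + γ_q` (`isUnit_one_add_frobeniusSeries`), contributing nothing to the
order. [folklore] -/
theorem order_map_toZMod_mul_of_isUnit {A V : IwasawaAlgebra p} (hV : IsUnit V) :
    (PowerSeries.map (PadicInt.toZMod (p := p)) (A * V)).order =
      (PowerSeries.map (PadicInt.toZMod (p := p)) A).order := by
  rw [map_mul, PowerSeries.order_mul,
    PowerSeries.order_zero_of_unit (hV.map (PowerSeries.map (PadicInt.toZMod (p := p)))), add_zero]

/-- The raising factor `1 + γ_q` of a non-split partner, as an instance: `ord_T (A·(1 + γ_q))‾ = ord_T Ā`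
for odd `p`. [cite: GreenbergVatsal2000, §1 (9)–(10)] -/
theorem order_map_toZMod_mul_one_add_frobeniusSeries (hp2 : p ≠ 2) (A : IwasawaAlgebra p) (q : ℕ) :
    (PowerSeries.map (PadicInt.toZMod (p := p)) (A * (1 + frobeniusSeries p q))).order =
      (PowerSeries.map (PadicInt.toZMod (p := p)) A).order :=
  order_map_toZMod_mul_of_isUnit
    (EisensteinPrimesAnalyticLambdaAbsoluteCount.isUnit_one_add_frobeniusSeries hp2 q)

end Algebra

/-! ## §2. X2 currency (crux 3, multiplicative rows): the socket of THEOREM C / C^mix -/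

section X2

variable {ι : Type*} {W : WeierstrassCurve ℚ} [W.IsElliptic] [W.IsGloballyMinimal]
  {N : ℕ} [NeZero N] {f : CuspForm (Gamma0 N) 2} {ϖ : ℚ} {L : PowerSeries ℚ_[p]}

/-- **X2: `μ_an(W) = 0` and `λ_an(W) = a` from ONE truncated congruence with a finite sum of plane terms
whose least order `a` is attained once.** Data: `(f, ϖ, L)` the datum of `X2.AnalyticMuLE` /
`X2.AnalyticLambdaEq` at `(W, p)` (odd multiplicative `p`) with an integral model `ι(G) = ϖ·L`; plane
terms `A : ι → Λ` on a `Finset` `s` with `ord_T Ā_{i₀} = a < ord_T Ā_i` (`i ≠ i₀`); the DISPLAYED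
hypothesis `[T^j]Ḡ = u·[T^j](Σ A_i)‾` for `j < K`, `u ≠ 0`, `a < K`. Conclusion:
`X2.AnalyticMuLE W p 0 ∧ X2.AnalyticLambdaEq W p a` (trivial zero included).
[cite: Mazur1977, III Cor. (8.5)] [cite: GreenbergVatsal2000, §1 (9)–(10)] [cite: Washington1997, §7.1] -/
theorem X2.analyticMuLE_zero_and_analyticLambdaEq_of_truncCongr_sum (hf : IsNewformOf W f)
    (hϖ : (ϖ : ℝ) * W.realPeriodRat = plusPeriod f)
    (hLs : W.HasSplitMultiplicativeReductionAtPrime p → IsSplitMultPAdicLFunctionOf f p L)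
    (hLn : ¬ W.HasSplitMultiplicativeReductionAtPrime p → IsMultPAdicLFunctionOf f p (-1) L)
    {G : IwasawaAlgebra p} (hG : iwasawaToPowerSeries p G = PowerSeries.C ((ϖ : ℚ) : ℚ_[p]) * L)
    (s : Finset ι) (A : ι → IwasawaAlgebra p) {i₀ : ι} (hi₀ : i₀ ∈ s) {a : ℕ}
    (ha : (PowerSeries.map (PadicInt.toZMod (p := p)) (A i₀)).order = a)
    (hlt : ∀ i ∈ s, i ≠ i₀ → (a : ℕ∞) < (PowerSeries.map (PadicInt.toZMod (p := p)) (A i)).order)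
    {u : ZMod p} (hu : u ≠ 0) {K : ℕ}
    (hcong : ∀ j < K, PowerSeries.coeff j (PowerSeries.map (PadicInt.toZMod (p := p)) G) =
      u * PowerSeries.coeff j (PowerSeries.map (PadicInt.toZMod (p := p)) (∑ i ∈ s, A i)))
    (hK : a < K) : X2.AnalyticMuLE W p 0 ∧ X2.AnalyticLambdaEq W p a := by
  obtain ⟨hGu, hlamG⟩ := hasUnitContent_and_lam_eq_of_truncCongr_sum s A hi₀ ha hlt hu hcong hK
  obtain ⟨k, hk⟩ := (hasUnitContent_iff_exists_norm_eq_one G).mp hGu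
  rw [EisensteinPrimesX2AnalyticLambdaCertificate.norm_coeff_eq_of_iota_eq hG] at hk
  refine ⟨EisensteinPrimesX2AnalyticLambdaCertificate.analyticMuLE_zero_of_norm_coeff_eq_one hf hϖ
      hLs hLn hk,
    (EisensteinPrimesX2AnalyticLambdaCertificate.analyticLambdaEq_iff_of_datum hf hϖ hLs hLn
      a).mpr fun G₁ hG₁ ↦ ?_⟩
  rw [iwasawaToPowerSeries_injective p (hG₁.trans hG.symm), hlamG]

/-- **X2, fed by VALUES** (THEOREM A⁺'s currency: one unit `c ∈ ℤ_p` and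
`‖(G − C(c)·Σ A_i)(ζ − 1)‖ ≤ 1/p` at every primitive `p^{m+1}`-th root of unity, `m ≥ n₀`).
Conclusion: `X2.AnalyticMuLE W p 0 ∧ X2.AnalyticLambdaEq W p a`.
[cite: Mazur1977, III Cor. (8.5)] [cite: Washington1997, §7.1–7.2, Thm. 7.3] -/
theorem X2.analyticMuLE_zero_and_analyticLambdaEq_of_valueCongr_sum (hf : IsNewformOf W f)
    (hϖ : (ϖ : ℝ) * W.realPeriodRat = plusPeriod f)
    (hLs : W.HasSplitMultiplicativeReductionAtPrime p → IsSplitMultPAdicLFunctionOf f p L)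
    (hLn : ¬ W.HasSplitMultiplicativeReductionAtPrime p → IsMultPAdicLFunctionOf f p (-1) L)
    {G : IwasawaAlgebra p} (hG : iwasawaToPowerSeries p G = PowerSeries.C ((ϖ : ℚ) : ℚ_[p]) * L)
    (s : Finset ι) (A : ι → IwasawaAlgebra p) {i₀ : ι} (hi₀ : i₀ ∈ s) {a : ℕ}
    (ha : (PowerSeries.map (PadicInt.toZMod (p := p)) (A i₀)).order = a)
    (hlt : ∀ i ∈ s, i ≠ i₀ → (a : ℕ∞) < (PowerSeries.map (PadicInt.toZMod (p := p)) (A i)).order)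
    {c : ℤ_[p]} (hc : IsUnit c) {n₀ : ℕ}
    (hval : ∀ m : ℕ, n₀ ≤ m → ∀ ζ : ℂ_[p], IsPrimitiveRoot ζ (p ^ (m + 1)) →
      ‖∑' k, ((algebraMap ℚ_[p] ℂ_[p]).comp (algebraMap ℤ_[p] ℚ_[p]))
          (PowerSeries.coeff k (G - PowerSeries.C c * ∑ i ∈ s, A i)) * (ζ - 1) ^ k‖ ≤ (p : ℝ)⁻¹) :
    X2.AnalyticMuLE W p 0 ∧ X2.AnalyticLambdaEq W p a :=
  X2.analyticMuLE_zero_and_analyticLambdaEq_of_truncCongr_sum hf hϖ hLs hLn hG s A hi₀ ha hlt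
    (EisensteinPrimesAnalyticLambdaValueCongruence.toZMod_ne_zero_of_isUnit hc) (K := a + 1)
    (fun j _ ↦ EisensteinPrimesAnalyticLambdaValueCongruence.forall_coeff_toZMod_eq_of_forall_norm_tsum_le
      hval j) (Nat.lt_succ_self _)

end X2

/-! ## §3. X1 currency (crux 5 / rows A1–A3, good ordinary): the same -/

section X1

variable {ι : Type*} {W : WeierstrassCurve ℚ} [W.IsElliptic] [W.IsGloballyMinimal]
  [NeZero (W.conductorNorm ℤ)] {f : CuspForm (Gamma0 (W.conductorNorm ℤ)) 2} {ϖ : ℚ}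

/-- **X1: `X1.MuPart.AnalyticMuLE W p 0 ∧ X1.ParitySqueeze.AnalyticLambdaEq W p a` from ONE truncated
congruence with a finite sum of plane terms whose least order `a` is attained once** (good ordinary
target; `ι(G) = ϖ·L_p(f, α)`, `α` the unit root).
[cite: Mazur1977, III Cor. (8.5)] [cite: GreenbergVatsal2000, §1 (9)–(10)] [cite: Washington1997, §7.1] -/
theorem X1.analyticMuLE_zero_and_analyticLambdaEq_of_truncCongr_sum (hf : IsNewformOf W f)
    (hϖ : (ϖ : ℝ) * W.realPeriodRat = plusPeriod f) {G : IwasawaAlgebra p}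
    (hG : iwasawaToPowerSeries p G =
      PowerSeries.C (ϖ : ℚ_[p]) * padicLFunction f (unitRoot W p : ℚ_[p]))
    (s : Finset ι) (A : ι → IwasawaAlgebra p) {i₀ : ι} (hi₀ : i₀ ∈ s) {a : ℕ}
    (ha : (PowerSeries.map (PadicInt.toZMod (p := p)) (A i₀)).order = a)
    (hlt : ∀ i ∈ s, i ≠ i₀ → (a : ℕ∞) < (PowerSeries.map (PadicInt.toZMod (p := p)) (A i)).order)
    {u : ZMod p} (hu : u ≠ 0) {K : ℕ}
    (hcong : ∀ j < K, PowerSeries.coeff j (PowerSeries.map (PadicInt.toZMod (p := p)) G) =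
      u * PowerSeries.coeff j (PowerSeries.map (PadicInt.toZMod (p := p)) (∑ i ∈ s, A i)))
    (hK : a < K) :
    X1.MuPart.AnalyticMuLE W p 0 ∧ X1.ParitySqueeze.AnalyticLambdaEq W p a := by
  obtain ⟨hGu, hlamG⟩ := hasUnitContent_and_lam_eq_of_truncCongr_sum s A hi₀ ha hlt hu hcong hK
  obtain ⟨k, hk⟩ := (hasUnitContent_iff_exists_norm_eq_one G).mp hGu
  rw [EisensteinPrimesX2AnalyticLambdaCertificate.norm_coeff_eq_of_iota_eq hG] at hk
  refine ⟨EisensteinPrimesX1AnalyticLambdaCertificate.analyticMuLE_zero_of_norm_coeff_eq_one hf hϖ hk,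
    (EisensteinPrimesX1AnalyticLambdaCertificate.analyticLambdaEq_iff_of_datum hf hϖ a).mpr
      fun G₁ hG₁ ↦ ?_⟩
  rw [iwasawaToPowerSeries_injective p (hG₁.trans hG.symm), hlamG]

/-- **X1, fed by VALUES** (`‖(G − C(c)·Σ A_i)(ζ − 1)‖ ≤ 1/p` at all primitive `p^{m+1}`-th roots of
unity, `m ≥ n₀`): `X1.MuPart.AnalyticMuLE W p 0 ∧ X1.ParitySqueeze.AnalyticLambdaEq W p a`.
[cite: Mazur1977, III Cor. (8.5)] [cite: Washington1997, §7.1–7.2, Thm. 7.3] -/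
theorem X1.analyticMuLE_zero_and_analyticLambdaEq_of_valueCongr_sum (hf : IsNewformOf W f)
    (hϖ : (ϖ : ℝ) * W.realPeriodRat = plusPeriod f) {G : IwasawaAlgebra p}
    (hG : iwasawaToPowerSeries p G =
      PowerSeries.C (ϖ : ℚ_[p]) * padicLFunction f (unitRoot W p : ℚ_[p]))
    (s : Finset ι) (A : ι → IwasawaAlgebra p) {i₀ : ι} (hi₀ : i₀ ∈ s) {a : ℕ}
    (ha : (PowerSeries.map (PadicInt.toZMod (p := p)) (A i₀)).order = a)
    (hlt : ∀ i ∈ s, i ≠ i₀ → (a : ℕ∞) < (PowerSeries.map (PadicInt.toZMod (p := p)) (A i)).order)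
    {c : ℤ_[p]} (hc : IsUnit c) {n₀ : ℕ}
    (hval : ∀ m : ℕ, n₀ ≤ m → ∀ ζ : ℂ_[p], IsPrimitiveRoot ζ (p ^ (m + 1)) →
      ‖∑' k, ((algebraMap ℚ_[p] ℂ_[p]).comp (algebraMap ℤ_[p] ℚ_[p]))
          (PowerSeries.coeff k (G - PowerSeries.C c * ∑ i ∈ s, A i)) * (ζ - 1) ^ k‖ ≤ (p : ℝ)⁻¹) :
    X1.MuPart.AnalyticMuLE W p 0 ∧ X1.ParitySqueeze.AnalyticLambdaEq W p a :=
  X1.analyticMuLE_zero_and_analyticLambdaEq_of_truncCongr_sum hf hϖ hG s A hi₀ ha hlt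
    (EisensteinPrimesAnalyticLambdaValueCongruence.toZMod_ne_zero_of_isUnit hc) (K := a + 1)
    (fun j _ ↦ EisensteinPrimesAnalyticLambdaValueCongruence.forall_coeff_toZMod_eq_of_forall_norm_tsum_le
      hval j) (Nat.lt_succ_self _)

end X1

end Summit.BirchSwinnertonDyer.BirchSwinnertonDyer.Theorems.EisensteinPrimesAnalyticLambdaSumCount

end
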